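import Summits.ABC.StewartYu.PadicG3TwoMain
import Summits.ABC.StewartYu.PadicG3TwoOfData
import Summits.ABC.StewartYu.GenThreeFramePivotTwo
import HarnessLib

/-!
# Cell abc-stewartyu, Gen-3 frame at `p = 2` (crux `Y07Two`, stmt-ABC-19659), F7 FINAL GLUE: `FrameTwoLast C d`
# from p5-g3's LEVEL INDUCTION `mainTwo` run on the set-up `TwoSetup.ofData` built from the data, plus the record

`Summits/ABC/StewartYu/PadicG3TwoFrameFromMain.lean` — cell `abc-stewartyu` (HOME `run/shared/lean/pub/abc-stewartyu/`),
route `PadicPrimesKummerThird`, seat p3 (g5), F-two LEAD (memo-09 §11 closing recipe, now a theorem).  Theorems.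

`GenThreeFramePivotTwo.FrameTwoLast C d` (the registered stub `stub_frameTwoLast` of the crux, up to the choice of
`C`) asks, for every pivot-last datum `(α, b, V, Vmax, W)` on `Fin (d+1)` under the negated bound, for parameters
with `FrameOutputTwo (d+1) α b (Fin.last d) …` AND `RecordTwo C (d+1) …`.  `frameTwoLast_of_mainTwo` reduces this
to: for every such datum, a schedule `σ : (ofData …).G3TwoSched`, a shape predicate `Sh`, the three level-`Prop`s of
p5-g3's `PadicG3TwoMain` on the set-up `S := TwoSetup.ofData d α b …` — `SiegelTwo σ Sh` (⇐ p3 `siegelTwo_feldman`),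
`KChainTwo σ Sh I` (`I ≤ Istar`; ⇐ the node-subset slab k-chains), `ThirdStepTwo σ Sh I` (`I < Istar`; ⇐ F5) —
the final ranges `(d+2)X ≤ Nfin Istar`, `(d+2)S₀ < Tfin Istar`, and `RecordTwo C (d+1) V Vmax W σ.D₀ S₀ X
(snoc (σ.Dbox Istar) (σ.Dθ Istar))`; the frame half is `frameOutputTwo_of_mainTwo` read back on the data by
`ofData_all`/`ofData_ball`.

WHAT THIS IS NOT: the three level-`Prop`s and the record themselves; no crux moves.

References: K. Yu, Acta Math. 211 (2013), §5–§6; Yu. V. Nesterenko, LNM 1819 (2003), §5.1.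
-/

noncomputable section

open Finset
open Literature.NumberTheory.Transcendental

namespace Summit.ABC.StewartYu.TwoSetup

/-- **`FrameTwoLast C d` FROM `mainTwo` ON `ofData` AND THE RECORD.** See the module docstring.
[cite: Yu2013, §5–§6; shape only] -/
theorem frameTwoLast_of_mainTwo {C : ℕ → ℝ} {d : ℕ}
    (h : ∀ (α : Fin (d + 1) → ℚ) (b : Fin (d + 1) → ℤ) (V : Fin (d + 1) → ℝ) (Vmax W : ℝ)
      (hα : ∀ j, 3 ≤ padicValRat 2 (α j - 1)),
      (∀ μ : Fin (d + 1) → ℤ, ∏ j, α j ^ μ j = 1 → μ = 0) →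
      (∀ κ : Fin (d + 1) → ℤ, (∃ γ : ℚ, ∏ j, α j ^ κ j = γ ^ 3) → ∀ j, (3 : ℤ) ∣ κ j) →
      (∀ j, Height.logHeight₁ (α j) ≤ V j) → (∀ j, 1 ≤ V j) → (∀ j, V j ≤ Vmax) →
      ∀ (hb : b (Fin.last d) ≠ 0)
        (hmin : ∀ j, b j ≠ 0 → padicValInt 2 (b (Fin.last d)) ≤ padicValInt 2 (b j)),
      (∀ j, Real.log (max 3 (|b j| : ℝ)) ≤ W) → 1 ≤ W →
      ¬ (padicValRat 2 (∏ j, α j ^ b j - 1) : ℝ) ≤ C (d + 1) * (∏ j, V j) * (W + Real.log (2 * Vmax)) →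
      ∃ (ι : Type) (σ : (ofData d α b hα hb hmin).G3TwoSched)
        (Sh : ℕ → (ofData d α b hα hb hmin).G3Fam ι → Prop) (S₀ X : ℕ),
        SiegelTwo σ Sh ∧ (∀ I, I ≤ σ.Istar → KChainTwo σ Sh I) ∧ (∀ I, I < σ.Istar → ThirdStepTwo σ Sh I) ∧
        (d + 1 + 1) * X ≤ σ.Nfin σ.Istar ∧ (d + 1 + 1) * S₀ < σ.Tfin σ.Istar ∧
        GenThreeFrameSpecTwo.RecordTwo C (d + 1) V Vmax W σ.D₀ S₀ X
          (Fin.snoc (σ.Dbox σ.Istar) (σ.Dθ σ.Istar))) :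
    GenThreeFramePivotTwo.FrameTwoLast C d := by
  intro α b V Vmax W hα hind hK hV hV1 hVmax hb hmin hW hW1 hneg
  obtain ⟨ι, σ, Sh, S₀, X, hS, hk, hth, hX, hT, hrec⟩ :=
    h α b V Vmax W hα hind hK hV hV1 hVmax hb hmin hW hW1 hneg
  refine ⟨σ.D₀, S₀, X, Fin.snoc (σ.Dbox σ.Istar) (σ.Dθ σ.Istar), ?_, hrec⟩
  have hout := frameOutputTwo_of_mainTwo σ Sh hS hk hth hX hT
  rw [ofData_all, ofData_ball] at hout
  exact hout

/-- **The registered stub's shape from `mainTwo`**: an admissible constant function `C ≤ c₁ⁿ` with `4 ≤ C 1` and,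
under the zero estimate, the `mainTwo` inputs + record for every `d ≥ 1` give the text of `stub_frameTwoLast`.
[cite: Yu2007, Main Thm (K = ℚ, ℘ = 2); shape only] -/
theorem stub_frameTwoLast_of_mainTwo {C : ℕ → ℝ} {c₁ : ℝ} (hc₁ : 1 ≤ c₁)
    (hC : ∀ m, 0 ≤ C m ∧ C m ≤ c₁ ^ m) (hC1 : 4 ≤ C 1)
    (h : Nesterenko2003_prop51 → ∀ d, 1 ≤ d →
      ∀ (α : Fin (d + 1) → ℚ) (b : Fin (d + 1) → ℤ) (V : Fin (d + 1) → ℝ) (Vmax W : ℝ)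
      (hα : ∀ j, 3 ≤ padicValRat 2 (α j - 1)),
      (∀ μ : Fin (d + 1) → ℤ, ∏ j, α j ^ μ j = 1 → μ = 0) →
      (∀ κ : Fin (d + 1) → ℤ, (∃ γ : ℚ, ∏ j, α j ^ κ j = γ ^ 3) → ∀ j, (3 : ℤ) ∣ κ j) →
      (∀ j, Height.logHeight₁ (α j) ≤ V j) → (∀ j, 1 ≤ V j) → (∀ j, V j ≤ Vmax) →
      ∀ (hb : b (Fin.last d) ≠ 0)
        (hmin : ∀ j, b j ≠ 0 → padicValInt 2 (b (Fin.last d)) ≤ padicValInt 2 (b j)),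
      (∀ j, Real.log (max 3 (|b j| : ℝ)) ≤ W) → 1 ≤ W →
      ¬ (padicValRat 2 (∏ j, α j ^ b j - 1) : ℝ) ≤ C (d + 1) * (∏ j, V j) * (W + Real.log (2 * Vmax)) →
      ∃ (ι : Type) (σ : (ofData d α b hα hb hmin).G3TwoSched)
        (Sh : ℕ → (ofData d α b hα hb hmin).G3Fam ι → Prop) (S₀ X : ℕ),
        SiegelTwo σ Sh ∧ (∀ I, I ≤ σ.Istar → KChainTwo σ Sh I) ∧ (∀ I, I < σ.Istar → ThirdStepTwo σ Sh I) ∧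
        (d + 1 + 1) * X ≤ σ.Nfin σ.Istar ∧ (d + 1 + 1) * S₀ < σ.Tfin σ.Istar ∧
        GenThreeFrameSpecTwo.RecordTwo C (d + 1) V Vmax W σ.D₀ S₀ X
          (Fin.snoc (σ.Dbox σ.Istar) (σ.Dθ σ.Istar))) :
    ∃ (C : ℕ → ℝ) (c₁ : ℝ), 1 ≤ c₁ ∧ (∀ m, 0 ≤ C m ∧ C m ≤ c₁ ^ m) ∧ 4 ≤ C 1 ∧
      (Nesterenko2003_prop51 → ∀ d, 1 ≤ d → GenThreeFramePivotTwo.FrameTwoLast C d) :=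
  ⟨C, c₁, hc₁, hC, hC1, fun hZ d hd => frameTwoLast_of_mainTwo (h hZ d hd)⟩

end Summit.ABC.StewartYu.TwoSetup

end
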